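import Summits.QuantumFields.BalabanUV.Beta.GAN24.LambdaSectorClassSlot
import Summits.QuantumFields.BalabanUV.Beta.GAN24.LambdaSectorClassSlotZero

/-!
# `BalabanUV.Beta.GAN24.LambdaSectorClassSlotOfTables` — binder row G-an2-4 ∕ (CONV-C), TRANSFER-III, the TABLE-GENERIC twin of this lineage's letters (Λ) `LambdaSectorClassSlot` §3 and
# `LambdaSectorClassSlotZero` §3 (g68): **THE Λ SECTORS `SLam Lc (lamCoeffK (KInvStep Lc (j+1)) (E2 d Lc (j+1)) Lc) H` AND `SLam Lc (lamCoeffOf (KInv Lc) Lc) H` OF THE SLOTTED STEP FAMILY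
# `SrecOf d Lc V H G` CARRY NO CLASS-SLOT CURRENT, FOR ANY HESSIAN TABLE `H` WITH THE RECORD LETTER (LH)** — `Σ'_u (c + (Φ(u_ν+1) − Φ(u_ν)))·SLam Lc lam H ν u v q a b = 0` at EVERY entry `(v q a b)`.

NOT IN PRINT; OUR BOOKKEEPING ([folklore] `tsum`∕Fubini bookkeeping BY NAME over this lineage's TABLE-FREE coefficient lemmas `LambdaSectorClassSlot.tsum_classSlot_lamCoeffK_eq_zero` ∕
`LambdaSectorClassSlotZero.tsum_classSlot_lamCoeffOf_eq_zero` (leaf-06's `ValueHessianLinearGauge` ∕ an3's `elCol` behind them), node 7a's `InterLevelTransport.SLam ∕ cwsum_apply ∕ locStencil_SLam`,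
`BalabanStepJetsSucc.abs_lamCoeffK_le ∕ decays_E2`, `BalabanStepJets.abs_lamCoeffOf_le`, `OneStepKernelFamily.decays_KInvStep`, `OneStepResolventKernel.decays_KInv`; G-an2-4 CRUX TEAM (2), leaf prover
`b2b-balaban-gan24-formalise-leaf-04`, gen 77).  HONEST FRAMING (cell contract, verbatim): «discharging `BetaPertH` makes Bałaban's UV stability UNCONDITIONAL — a real constructive-QFT result;
it is NOT the continuum limit and NOT the Clay problem.»  HONEST DEPENDENCY (verbatim): «continuum YM on T⁴ ⇐ BetaPertH ∧ nine spine estimates (0/9 proved); BetaPertH ⇐ (D1) ∧ (D4) ∧ CAP+tail;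
G-an2-4 gates asym, D1 and NE2/3/4.»

WHY.  In the (E) tower the Λ sectors read an1's comb table `hessFFAt ρ`; at row D1's literal of record (III′) the slot recursion `SrecOf d Lc tabs.V tabs.H (GcombSh Lc)` reads the record's
`tabs.H` (an1's `symHessFFAt ρ_c Lc`).  The g68 proofs used of the table ONLY its bi-localisation at the coarse bond (for one Fubini exchange) — the record letter (LH) `∀ δ ≥ 0, ∃ C,
VertexFamily H Lc C δ` — and the vanishing itself is the TABLE-FREE identity «the conversion coefficients kill class slot data».  This file says so once, for any coefficient family with an
exponential bound and any vertex family, at EVERY kernel entry (so the multiplier free legs need no separate (H-fm0) case).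

WHAT ([folklore]; generic `d`, `[NeZero Lc]`; 0 `def`, 0 cited facts, 0 `def … : Prop`, 0 sorry): §1 **`tsum_classSlot_SLam_eq_zero`** — for `lam` with `|lam μ Y ν u| ≤ CL·e^{−δ|Lc•Y − u|₁}` whose
class-slot contraction vanishes (`∀ μ Y, Σ'_u (c + dΦ(u_ν))·lam μ Y ν u = 0`) and any `VertexFamily H Lc CH δ` (`0 < δ`): `Σ'_u (c + dΦ(u_ν))·SLam Lc lam H ν u v q a b = 0`; §2 the two instances under (LH):
**`tsum_classSlot_lamSectorK_eq_zero_of_tables`** (level `j+1`: `lam := lamCoeffK (KInvStep Lc (j+1)) (E2 d Lc (j+1)) Lc`), **`tsum_classSlot_lamSectorOf_eq_zero_of_tables`** (level `0`: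
`lam := lamCoeffOf (KInv Lc) Lc`); §3 the sectors are local stencil families under (LH): `exists_locStencil_lamSectorK_of_tables`, `exists_locStencil_lamSectorOf_of_tables`.
Asserts NO value of Bałaban's tables; discharges NOTHING of (C)sym ∕ (hW, hWall) ∕ (hS, hSall); NEVER «G-an2-4 closed» as (CONV-C); NOT D1, NOT `BetaPertH`, NOT continuum, NOT Clay.  2026-08-25; no
existing file touched.
-/

noncomputable section

open Finset
open scoped BigOperators
open Literature.MathematicalPhysics.QuantumFieldTheory
open Literature.MathematicalPhysics.QuantumFieldTheory.Balaban1983to89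
open Literature.MathematicalPhysics.QuantumFieldTheory.Balaban1983to89.Beta
open B12Sec2to5 (l1 l1_nonneg)
open ExpKernelCalculus (Site MKer Decays BiLoc VertexFamily Zl Zl_nonneg summable_exp_shift' tsum_exp_shift' l1_sub_symm)
open OneStepResolventKernel (Fib LocStencil KInv decays_KInv decays_mono)
open OneStepKernelFamily (KInvStep decays_KInvStep)
open InterLevelTransport (SLam cwsum_apply locStencil_SLam)
open BalabanStepJets (lamCoeffOf abs_lamCoeffOf_le)
open BalabanStepJetsSucc (E2 decays_E2 lamCoeffK abs_lamCoeffK_le)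
open Summit.QuantumFields.BalabanUV.Beta.GAN24.ResolventLegCharges (summable_exp_coarse')
open Summit.QuantumFields.BalabanUV.Beta.GAN24.LambdaSectorClassSlot (tsum_classSlot_lamCoeffK_eq_zero)
open Summit.QuantumFields.BalabanUV.Beta.GAN24.LambdaSectorClassSlotZero (tsum_classSlot_lamCoeffOf_eq_zero)

namespace Summit.QuantumFields.BalabanUV.Beta.GAN24.LambdaSectorClassSlotOfTables

variable {d : ℕ} {Lc : ℕ} [NeZero Lc]

/-! ## §1 A Λ-type sector `SLam Lc lam H` carries no class-slot current when its coefficients kill class slot data -/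

/-- [folklore] **THE Λ-TYPE SECTOR `SLam Lc lam H` CARRIES NO CLASS-SLOT CURRENT** (any exponentially bounded coefficient family `lam` whose class-slot contraction vanishes, any vertex
family `H` at the same rate, EVERY entry `(v q a b)`): `Σ'_u (c + (Φ(u_ν+1) − Φ(u_ν)))·SLam Lc lam H ν u v q a b = 0` — unfold `SLam`, one `(u,Y)` Fubini per `μ`, the inner `u`-sum dies. -/
theorem tsum_classSlot_SLam_eq_zero {lam : Fin (d + 1) → Site (d + 1) → Fin (d + 1) → Site (d + 1) → ℝ} {CL δ : ℝ} (hδ : 0 < δ)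
    (hlam : ∀ μ Y ν u, |lam μ Y ν u| ≤ CL * Real.exp (-δ * l1 ((Lc : ℤ) • Y - u)))
    {H : Fin (d + 1) → Site (d + 1) → MKer (d + 1) (Fib d)} {CH : ℝ} (hH : VertexFamily H Lc CH δ)
    (ν : Fin (d + 1)) (c : ℝ) (Φ : ℤ → ℝ) {B : ℝ} (hΦ : ∀ s, |Φ s| ≤ B)
    (hlam0 : ∀ (μ : Fin (d + 1)) (Y : Site (d + 1)), ∑' u : Site (d + 1), (c + (Φ (u ν + 1) - Φ (u ν))) * lam μ Y ν u = 0)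
    (v q : Site (d + 1)) (a b : Fib d) :
    ∑' u : Site (d + 1), (c + (Φ (u ν + 1) - Φ (u ν))) * SLam Lc lam H ν u v q a b = 0 := by
  classical
  have hLc : 1 ≤ Lc := Nat.one_le_iff_ne_zero.mpr (NeZero.ne Lc)
  have hCL0 : 0 ≤ CL := by
    have h := (abs_nonneg _).trans (hlam 0 0 0 0)
    have hexp : 0 < Real.exp (-δ * l1 (((Lc : ℕ) : ℤ) • (0 : Site (d + 1)) - 0)) := Real.exp_pos _
    nlinarith
  have hCH0 : 0 ≤ CH := (hH 0 0).nonneg (Sum.inl 0)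
  have hs : ∀ u : Site (d + 1), |c + (Φ (u ν + 1) - Φ (u ν))| ≤ |c| + (B + B) := fun u =>
    (abs_add_le _ _).trans (add_le_add le_rfl ((abs_sub _ _).trans (add_le_add (hΦ _) (hΦ _))))
  have hBs : 0 ≤ |c| + (B + B) := (abs_nonneg _).trans (hs 0)
  -- unfold the sector entry: `SLam ν u v q a b = −Σ_μ Σ'_Y lam(μ,Y,ν,u)·H(μ,Y) v q a b`
  have ept : ∀ u : Site (d + 1), SLam Lc lam H ν u v q a b = -∑ μ : Fin (d + 1), ∑' Y : Site (d + 1), lam μ Y ν u * H μ Y v q a b := by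
    intro u
    simp only [SLam, cwsum_apply]
  -- the `(u, Y)` family per `μ` is absolutely summable
  have hpair : ∀ μ : Fin (d + 1), Summable fun uY : Site (d + 1) × Site (d + 1) => (c + (Φ (uY.1 ν + 1) - Φ (uY.1 ν))) * (lam μ uY.2 ν uY.1 * H μ uY.2 v q a b) := by
    intro μ
    have hMs : Summable fun uY : Site (d + 1) × Site (d + 1) => (|c| + (B + B)) * (CL * CH) *
        (Real.exp (-δ * l1 ((Lc : ℤ) • uY.2 - uY.1)) * Real.exp (-δ * l1 (v - (Lc : ℤ) • uY.2))) := by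
      refine Summable.mul_left _ ?_
      have hs' : Summable fun Yu : Site (d + 1) × Site (d + 1) => Real.exp (-δ * l1 ((Lc : ℤ) • Yu.1 - Yu.2)) * Real.exp (-δ * l1 (v - (Lc : ℤ) • Yu.1)) := by
        refine (summable_prod_of_nonneg (fun _ => mul_nonneg (Real.exp_pos _).le (Real.exp_pos _).le)).2 ⟨fun Y => ?_, ?_⟩
        · have h := (summable_exp_shift' hδ ((Lc : ℤ) • Y)).mul_right (Real.exp (-δ * l1 (v - (Lc : ℤ) • Y)))
          exact h.congr fun u => by rw [l1_sub_symm u ((Lc : ℤ) • Y)]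
        · have hb : ∀ Y : Site (d + 1), ∑' u : Site (d + 1), Real.exp (-δ * l1 ((Lc : ℤ) • Y - u)) * Real.exp (-δ * l1 (v - (Lc : ℤ) • Y)) =
              Zl (d + 1) δ * Real.exp (-δ * l1 (v - (Lc : ℤ) • Y)) := by
            intro Y
            rw [tsum_mul_right]
            congr 1
            rw [← tsum_exp_shift' (c := δ) ((Lc : ℤ) • Y)]
            exact tsum_congr fun u => by rw [l1_sub_symm ((Lc : ℤ) • Y) u]
          simp only [hb]
          exact (summable_exp_coarse' (d := d) hLc hδ v).mul_left _
      exact ((Equiv.prodComm (Site (d + 1)) (Site (d + 1))).summable_iff.2 hs').congr fun uY => by simp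
    refine Summable.of_norm_bounded hMs (fun uY => ?_)
    rw [Real.norm_eq_abs, abs_mul, abs_mul]
    have h1 := hlam μ uY.2 ν uY.1
    have h2 : |H μ uY.2 v q a b| ≤ CH * Real.exp (-δ * l1 (v - (Lc : ℤ) • uY.2)) := by
      refine (hH μ uY.2 v q _ _).trans (mul_le_mul_of_nonneg_left (Real.exp_le_exp.2 ?_) hCH0)
      nlinarith [l1_nonneg (v - (Lc : ℤ) • uY.2), l1_nonneg (q - (Lc : ℤ) • uY.2)]
    calc |c + (Φ (uY.1 ν + 1) - Φ (uY.1 ν))| * (|lam μ uY.2 ν uY.1| * |H μ uY.2 v q a b|)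
        ≤ (|c| + (B + B)) * ((CL * Real.exp (-δ * l1 ((Lc : ℤ) • uY.2 - uY.1))) * (CH * Real.exp (-δ * l1 (v - (Lc : ℤ) • uY.2)))) :=
          mul_le_mul (hs _) (mul_le_mul h1 h2 (abs_nonneg _) (by positivity)) (by positivity) hBs
      _ = _ := by ring
  -- summand rewritten, finite `μ`-sum out, Fubini per `μ`, inner `u`-sum killed by `hlam0`
  have e : ∀ u : Site (d + 1), (c + (Φ (u ν + 1) - Φ (u ν))) * SLam Lc lam H ν u v q a b =
      -∑ μ : Fin (d + 1), (c + (Φ (u ν + 1) - Φ (u ν))) * ∑' Y : Site (d + 1), lam μ Y ν u * H μ Y v q a b := by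
    intro u; rw [ept u, mul_neg, Finset.mul_sum]
  rw [tsum_congr e, tsum_neg, neg_eq_zero, Summable.tsum_finsetSum (fun μ _ => ((hpair μ).prod).congr fun u => by dsimp only; exact tsum_mul_left)]
  refine Finset.sum_eq_zero fun μ _ => ?_
  have hP := hpair μ
  have hP' : Summable fun Yu : Site (d + 1) × Site (d + 1) => (c + (Φ (Yu.2 ν + 1) - Φ (Yu.2 ν))) * (lam μ Yu.1 ν Yu.2 * H μ Yu.1 v q a b) :=
    ((Equiv.prodComm (Site (d + 1)) (Site (d + 1))).summable_iff.2 hP).congr fun Yu => by simp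
  calc ∑' u : Site (d + 1), (c + (Φ (u ν + 1) - Φ (u ν))) * ∑' Y : Site (d + 1), lam μ Y ν u * H μ Y v q a b
      = ∑' u : Site (d + 1), ∑' Y : Site (d + 1), (c + (Φ (u ν + 1) - Φ (u ν))) * (lam μ Y ν u * H μ Y v q a b) :=
        tsum_congr fun u => (tsum_mul_left).symm
    _ = ∑' uY : Site (d + 1) × Site (d + 1), (c + (Φ (uY.1 ν + 1) - Φ (uY.1 ν))) * (lam μ uY.2 ν uY.1 * H μ uY.2 v q a b) := (hP.tsum_prod).symm
    _ = ∑' Yu : Site (d + 1) × Site (d + 1), (c + (Φ (Yu.2 ν + 1) - Φ (Yu.2 ν))) * (lam μ Yu.1 ν Yu.2 * H μ Yu.1 v q a b) := by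
        rw [← (Equiv.prodComm (Site (d + 1)) (Site (d + 1))).tsum_eq (fun uY : Site (d + 1) × Site (d + 1) =>
          (c + (Φ (uY.1 ν + 1) - Φ (uY.1 ν))) * (lam μ uY.2 ν uY.1 * H μ uY.2 v q a b))]
        exact tsum_congr fun Yu => by simp [Equiv.prodComm_apply]
    _ = ∑' Y : Site (d + 1), ∑' u : Site (d + 1), (c + (Φ (u ν + 1) - Φ (u ν))) * (lam μ Y ν u * H μ Y v q a b) := hP'.tsum_prod
    _ = ∑' Y : Site (d + 1), (∑' u : Site (d + 1), (c + (Φ (u ν + 1) - Φ (u ν))) * lam μ Y ν u) * H μ Y v q a b := by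
        refine tsum_congr fun Y => ?_
        rw [← tsum_mul_right]
        exact tsum_congr fun u => by ring
    _ = 0 := by simp only [hlam0 μ, zero_mul, tsum_zero]

/-! ## §2 The two Λ sectors of the slotted step family, under the record letter (LH) -/

section Tables

variable {H : Fin (d + 1) → Site (d + 1) → MKer (d + 1) (Fib d)}

/-- [folklore] **THE LEVEL-`(j+1)` Λ SECTOR OF `SrecOf d Lc V H G` CARRIES NO CLASS-SLOT CURRENT**, for ANY Hessian table with (LH): every entry `(v q a b)`,
`Σ'_u (c + dΦ(u_ν))·SLam Lc (lamCoeffK (KInvStep Lc (j+1)) (E2 d Lc (j+1)) Lc) H ν u v q a b = 0` (§1 with `tsum_classSlot_lamCoeffK_eq_zero` and `abs_lamCoeffK_le`). -/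
theorem tsum_classSlot_lamSectorK_eq_zero_of_tables (hH : ∀ δ : ℝ, 0 ≤ δ → ∃ C : ℝ, VertexFamily H Lc C δ) (j : ℕ) (ν : Fin (d + 1))
    (c : ℝ) (Φ : ℤ → ℝ) {B : ℝ} (hΦ : ∀ s, |Φ s| ≤ B) (v q : Site (d + 1)) (a b : Fib d) :
    ∑' u : Site (d + 1), (c + (Φ (u ν + 1) - Φ (u ν))) *
        SLam Lc (lamCoeffK (KInvStep (d := d) Lc (j + 1)) (E2 d Lc (j + 1)) Lc) H ν u v q a b = 0 := by
  obtain ⟨δA, CA, hδA, hCA, hA⟩ := decays_KInvStep (Lc := Lc) (d := d) (j + 1)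
  obtain ⟨δE, CE, hδE, hCE, hE⟩ := decays_E2 (d := d) (Lc := Lc) (j + 1)
  obtain ⟨n, hn0, hnA, hnE⟩ : ∃ n : ℝ, 0 < n ∧ n ≤ δA ∧ n ≤ δE := ⟨min δA δE, lt_min hδA hδE, min_le_left _ _, min_le_right _ _⟩
  have hA' : Decays (KInvStep (d := d) Lc (j + 1)) CA n := decays_mono hA hCA le_rfl hnA
  have hE' : Decays (E2 d Lc (j + 1)) CE n := decays_mono hE hCE le_rfl hnE
  have hc := abs_lamCoeffK_le hA' hE' hn0 Lc
  obtain ⟨CH, hHn⟩ := hH (n / 2) (by positivity)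
  exact tsum_classSlot_SLam_eq_zero (half_pos hn0) (fun μ Y ν' u => hc μ Y ν' u) hHn ν c Φ hΦ
    (fun μ Y => tsum_classSlot_lamCoeffK_eq_zero (Lc := Lc) (j + 1) μ ν Y c Φ hΦ) v q a b

/-- [folklore] **THE LEVEL-`0` Λ SECTOR OF `SrecOf d Lc V H G` CARRIES NO CLASS-SLOT CURRENT**, for ANY Hessian table with (LH): every entry `(v q a b)`,
`Σ'_u (c + dΦ(u_ν))·SLam Lc (lamCoeffOf (KInv Lc) Lc) H ν u v q a b = 0` (§1 with `tsum_classSlot_lamCoeffOf_eq_zero` and `abs_lamCoeffOf_le`). -/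
theorem tsum_classSlot_lamSectorOf_eq_zero_of_tables (hH : ∀ δ : ℝ, 0 ≤ δ → ∃ C : ℝ, VertexFamily H Lc C δ) (ν : Fin (d + 1))
    (c : ℝ) (Φ : ℤ → ℝ) {B : ℝ} (hΦ : ∀ s, |Φ s| ≤ B) (v q : Site (d + 1)) (a b : Fib d) :
    ∑' u : Site (d + 1), (c + (Φ (u ν + 1) - Φ (u ν))) *
        SLam Lc (lamCoeffOf (KInv (N := Lc) (d := d)) Lc) H ν u v q a b = 0 := by
  obtain ⟨δ₀, C, hδ₀, hC, hdec⟩ := decays_KInv (N := Lc) (d := d)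
  have hc := abs_lamCoeffOf_le (N := Lc) hdec hC hδ₀.le
  obtain ⟨CH, hH0⟩ := hH δ₀ hδ₀.le
  exact tsum_classSlot_SLam_eq_zero hδ₀ (fun μ Y ν' u => hc μ Y ν' u) hH0 ν c Φ hΦ
    (fun μ Y => tsum_classSlot_lamCoeffOf_eq_zero hdec hδ₀ Lc μ ν Y c Φ hΦ) v q a b

/-! ## §3 Both sectors are local stencil families under (LH) -/

/-- [folklore] The level-`(j+1)` Λ sector over ANY Hessian table with (LH) is a local stencil family (node 7a's `locStencil_SLam`, constants as in an2's `locStencil_SrecOf`). -/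
theorem exists_locStencil_lamSectorK_of_tables (hH : ∀ δ : ℝ, 0 ≤ δ → ∃ C : ℝ, VertexFamily H Lc C δ) (j : ℕ) :
    ∃ C δ : ℝ, 0 < δ ∧ LocStencil (SLam Lc (lamCoeffK (KInvStep (d := d) Lc (j + 1)) (E2 d Lc (j + 1)) Lc) H) C δ := by
  obtain ⟨δA, CA, hδA, hCA, hA⟩ := decays_KInvStep (Lc := Lc) (d := d) (j + 1)
  obtain ⟨δE, CE, hδE, hCE, hE⟩ := decays_E2 (d := d) (Lc := Lc) (j + 1)
  obtain ⟨n, hn0, hnA, hnE⟩ : ∃ n : ℝ, 0 < n ∧ n ≤ δA ∧ n ≤ δE := ⟨min δA δE, lt_min hδA hδE, min_le_left _ _, min_le_right _ _⟩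
  have hA' : Decays (KInvStep (d := d) Lc (j + 1)) CA n := decays_mono hA hCA le_rfl hnA
  have hE' : Decays (E2 d Lc (j + 1)) CE n := decays_mono hE hCE le_rfl hnE
  have hc := abs_lamCoeffK_le hA' hE' hn0 Lc
  obtain ⟨CH, hQ⟩ := hH (n / 2) (by positivity)
  have h3 := locStencil_SLam (N := Lc) hc hQ (by positivity)
    (mul_nonneg (mul_nonneg (Nat.cast_nonneg _) (mul_nonneg hCA hCE)) (Zl_nonneg (by linarith)))
  exact ⟨_, _, by positivity, h3⟩

/-- [folklore] The level-`0` Λ sector over ANY Hessian table with (LH) is a local stencil family. -/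
theorem exists_locStencil_lamSectorOf_of_tables (hH : ∀ δ : ℝ, 0 ≤ δ → ∃ C : ℝ, VertexFamily H Lc C δ) :
    ∃ C δ : ℝ, 0 < δ ∧ LocStencil (SLam Lc (lamCoeffOf (KInv (N := Lc) (d := d)) Lc) H) C δ := by
  obtain ⟨δ₀, C, hδ₀, hC, hdec⟩ := decays_KInv (N := Lc) (d := d)
  have hc := abs_lamCoeffOf_le (N := Lc) hdec hC hδ₀.le
  obtain ⟨CH, hQ⟩ := hH δ₀ hδ₀.le
  have h3 := locStencil_SLam (N := Lc) hc hQ hδ₀ (mul_nonneg (mul_nonneg (by positivity) hC) (Real.exp_pos _).le)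
  exact ⟨_, _, by positivity, h3⟩

end Tables

end Summit.QuantumFields.BalabanUV.Beta.GAN24.LambdaSectorClassSlotOfTables

end
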